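import Literature.LinearAlgebra.Matrix.MatrixScalingPattern
import HarnessLib

/-!
# Symmetric scaling `DAD` of a symmetric nonnegative matrix to prescribed row sums (Brualdi's DAD theorem, Idel
# Theorem 5.4) and the bipartite-double reduction (Idel Observation 5.5)

Layer `Literature/LinearAlgebra/Matrix`, namespace `Literature.LinearAlgebra.Matrix.SymmetricMatrixScaling`.
Written for lane `lit-hodgefound` (prover seat `lit-hodgefound-p31`, gen 41, row g41-#12); sequel of
✔ `MatrixScalingPattern.lean` (Idel Theorem 3.1 and the uniqueness of the scaled matrix), from which everything here
is derived exactly as the survey indicates. Everything is PROVED; no definition, no named fact. The positive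
symmetric case (`(a_ij z_i z_j)` doubly stochastic, Bapat–Raghavan Ch. 3 Ex. 3) is ✔ `SinkhornScaling.sinkhorn_symmetric`.

## Source (held text, verbatim)

M. Idel, *A review of matrix scaling and Sinkhorn's normal form for matrices and positive maps*, arXiv:1609.06349
[cite: Idel2016] (held text `paper:arxiv-1609.06349`), §5, p0015–p0016:
«Let us first focus on the case where `A` is symmetric. It seems natural that this follows directly from Sinkhorn's
theorem: If `D₁AD₂` has equal row-sums and `A` is symmetric, so does `D₂AD₁`. By uniqueness of `D_i` up to scaling,
this implies that one can choose `D₁ = D₂`. … [csi72] shows that a doubly stochastic scaling exists if and only if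
there exists a symmetric doubly stochastic matrix with the same zero pattern if and only if the matrix has total
support. This was extended in [bru74] to cover the case of arbitrary row sums giving the following theorem:
**Theorem 5.4 ([bru74]).** Let `A ∈ ℝ^{n×n}` be a symmetric nonnegative matrix. Then the following are equivalent:
• There exists a diagonal matrix `D` with positive entries such that `DAD` has row sums given by `r ∈ ℝ^n_+`.
• There exists a symmetric nonnegative matrix `B` with the same pattern as `A` and row sums `r`. • For all
partitions `{I,J,K}` … Furthermore, the scaling is unique. The equivalence of 2. and 3. is given in [bru68]. 1.
follows from 2. using Sinkhorn's theorem … Using the uniqueness in Sinkhorn's theorem then provides uniqueness for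
the scaling.» «**Observation 5.5.** Let `A ∈ ℝ^{m×n}` be a matrix and `r ∈ ℝ^m_+, c ∈ ℝ^n_+` be two prescribed
vectors. Then `A` has an equivalence scaling if and only if the following symmetric matrix `A' = (0 A; Aᵀ 0)` has a
row-sum symmetric scaling to `(r')ᵀ = (rᵀ, cᵀ)`. *Proof.* … setting `D' := diag(D₁, D₂)` we have
`D'A'D' = (0 D₁AD₂; D₂AᵀD₁ 0)` and clearly `D'A'D'e = (rᵀ, cᵀ)ᵀ`. Conversely …» ([bru74] = R. A. Brualdi, *The DAD
theorem for arbitrary row sums*, Proc. AMS 45 (1974); [csi72] = Csima–Datta 1972; cited through Idel.)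

## What is proved, and how

* §1 `exists_symmetric_scaling_of_pattern` ((2) ⇒ (1)): Theorem 3.1 (✔ `MatrixScalingPattern.exists_scaling_of_pattern`)
  gives `D(y) A D(x)` with margins `(r, r)`; by the symmetry of `A` the flipped `D(x) A D(y)` has the same margins,
  so the two scaled matrices coincide (✔ `MatrixScalingPattern.scaledMatrix_unique`): `x_i y_j = y_i x_j` on the
  pattern, whence `d = √(xy)` satisfies `d_i a_ij d_j = y_i a_ij x_j`. `symmetric_pattern_of_scaling`
  ((1) ⇒ (2)), `Idel2016_thm_5_4` ((1) ⇔ (2)). Uniqueness: the MATRIX `DAD` is unique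
  (`symmetric_scaledMatrix_unique`), and `D` is unique when `a_ii > 0` for all `i`
  (`symmetric_scaling_unique_of_pos_diag`); `symmetric_scaling_not_unique` records that `D` itself is not unique in
  general (`A = (0 1; 1 0)`, `D = I` and `D = diag(2, ½)`).
* §2 `exists_symmetric_doublyStochastic_scaling_iff`: the doubly stochastic case (`r = e`) in Mathlib's vocabulary
  (`diagonal d * A * diagonal d ∈ doublyStochastic ℝ n` ⇔ a symmetric doubly stochastic matrix has the pattern of
  `A`) — the first equivalence Idel attributes to [csi72].
* §3 `Idel2016_obs_5_5`: equivalence scalings `(x, y)` of `A : m × n` to margins `(r, c)` ↔ symmetric scalings `d`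
  of `fromBlocks 0 A Aᵀ 0` on `m ⊕ n` to row sums `Sum.elim r c` (`d = (y, x)`).

DECLARED deviations. (i) Condition (3) of Theorem 5.4 (the partition inequalities, [bru68]) and the «total support»
clause of [csi72] are NOT formalised. (ii) «the scaling is unique» is proved for the scaled matrix `DAD`; for `D` it
is proved under a positive diagonal and refuted in general by the `2 × 2` example (so the printed clause is read as
uniqueness of `DAD`). (iii) Scalings are written entrywise `d_i a_ij d_j`; §2 gives the `Matrix.diagonal` form.
-/

open Matrix Finset

namespace Literature.LinearAlgebra.Matrix.SymmetricMatrixScaling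

variable {m n : Type*} [Fintype m] [Fintype n]
variable {A B : Matrix n n ℝ} {r : n → ℝ}

/-! ### §1 Brualdi's DAD theorem (Idel Theorem 5.4, (1) ⇔ (2)) -/

/-- **Idel Theorem 5.4 ([bru74]), (2) ⇒ (1).** Let `A ≥ 0` be symmetric and let `B ≥ 0` be symmetric with the
pattern of `A` and row sums `r`. Then there is a positive `d` with `(d_i a_ij d_j)` having row sums `r` («1. follows
from 2. using Sinkhorn's theorem»: an equivalence scaling `D(y) A D(x)` to margins `(r, r)` exists by Theorem 3.1;
its transpose-flip `D(x) A D(y)` is another one, so the two scaled matrices coincide (uniqueness of the scaled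
matrix), i.e. `x_i y_j = y_i x_j` on the pattern, and `d = √(xy)` works). [cite: Idel2016, §5 Theorem 5.4
((2) ⇒ (1)), p0015–p0016] -/
theorem exists_symmetric_scaling_of_pattern (hA : ∀ i j, 0 ≤ A i j) (hAs : ∀ i j, A i j = A j i)
    (hB : ∀ i j, 0 ≤ B i j) (hBs : ∀ i j, B i j = B j i) (hpat : ∀ i j, A i j = 0 ↔ B i j = 0)
    (hBr : ∀ i, ∑ j, B i j = r i) :
    ∃ d : n → ℝ, (∀ i, 0 < d i) ∧ ∀ i, ∑ j, d i * A i j * d j = r i := by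
  have hBc : ∀ j, ∑ i, B i j = r j := fun j ↦ by
    rw [← hBr j]; exact sum_congr rfl fun i _ ↦ hBs i j
  obtain ⟨x, y, hx, hy, hrow, hcol⟩ := MatrixScalingPattern.exists_scaling_of_pattern hA hB hpat hBr hBc
  -- the flipped scaling `D(x) A D(y)` has the same margins
  have hrow' : ∀ i, ∑ j, x i * A i j * y j = r i := fun i ↦ by
    rw [← hcol i]; exact sum_congr rfl fun j _ ↦ by rw [hAs i j]; ring
  have hcol' : ∀ j, ∑ i, x i * A i j * y j = r j := fun j ↦ by
    rw [← hrow j]; exact sum_congr rfl fun i _ ↦ by rw [hAs i j]; ring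
  have hflip : ∀ i j, x i * A i j * y j = y i * A i j * x j := fun i j ↦
    MatrixScalingPattern.scaledMatrix_unique hA hx hy hy hx (fun i ↦ by rw [hrow' i, hrow i])
      (fun j ↦ by rw [hcol' j, hcol j]) i j
  refine ⟨fun i ↦ Real.sqrt (x i * y i), fun i ↦ Real.sqrt_pos.2 (mul_pos (hx i) (hy i)), fun i ↦ ?_⟩
  rw [← hrow i]
  refine sum_congr rfl fun j _ ↦ ?_
  rcases eq_or_ne (A i j) 0 with h0 | h0
  · rw [h0]; ring
  · have hxy : x i * y j = y i * x j := by
      have h := hflip i j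
      have : x i * y j * A i j = y i * x j * A i j := by linarith [h]
      exact mul_right_cancel₀ h0 this
    have hd : Real.sqrt (x i * y i) * Real.sqrt (x j * y j) = y i * x j := by
      rw [← Real.sqrt_mul (mul_pos (hx i) (hy i)).le,
        show x i * y i * (x j * y j) = (y i * x j) * (x i * y j) by ring, hxy,
        Real.sqrt_mul_self (mul_pos (hy i) (hx j)).le]
    calc Real.sqrt (x i * y i) * A i j * Real.sqrt (x j * y j)
        = Real.sqrt (x i * y i) * Real.sqrt (x j * y j) * A i j := by ring
      _ = y i * A i j * x j := by rw [hd]; ring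

omit [Fintype n] in
/-- **Idel Theorem 5.4, (1) ⇒ (2)**: a symmetric scaling `(d_i a_ij d_j)` is itself a symmetric nonnegative matrix
with the pattern of `A`. [cite: Idel2016, §5 Theorem 5.4 ((1) ⇒ (2)), p0015–p0016] -/
theorem symmetric_pattern_of_scaling (hA : ∀ i j, 0 ≤ A i j) (hAs : ∀ i j, A i j = A j i) {d : n → ℝ}
    (hd : ∀ i, 0 < d i) :
    (∀ i j, 0 ≤ d i * A i j * d j) ∧ (∀ i j, d i * A i j * d j = d j * A j i * d i) ∧
      ∀ i j, A i j = 0 ↔ d i * A i j * d j = 0 := by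
  refine ⟨fun i j ↦ mul_nonneg (mul_nonneg (hd i).le (hA i j)) (hd j).le, fun i j ↦ by rw [hAs i j]; ring,
    fun i j ↦ ⟨fun h ↦ by simp [h], fun h ↦ ?_⟩⟩
  rcases mul_eq_zero.1 h with h1 | h1
  · rcases mul_eq_zero.1 h1 with h2 | h2
    · exact absurd h2 (hd i).ne'
    · exact h2
  · exact absurd h1 (hd j).ne'

/-- **Idel Theorem 5.4 (Brualdi 1974), (1) ⇔ (2).** «Let `A ∈ ℝ^{n×n}` be a symmetric nonnegative matrix. Then the
following are equivalent: • There exists a diagonal matrix `D` with positive entries such that `DAD` has row sums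
given by `r ∈ ℝ^n_+`. • There exists a symmetric nonnegative matrix `B` with the same pattern as `A` and row sums
`r`.» [cite: Idel2016, §5 Theorem 5.4 ((1) ⇔ (2)), p0015–p0016] -/
theorem Idel2016_thm_5_4 (hA : ∀ i j, 0 ≤ A i j) (hAs : ∀ i j, A i j = A j i) :
    (∃ d : n → ℝ, (∀ i, 0 < d i) ∧ ∀ i, ∑ j, d i * A i j * d j = r i) ↔
      ∃ B : Matrix n n ℝ, (∀ i j, 0 ≤ B i j) ∧ (∀ i j, B i j = B j i) ∧ (∀ i j, A i j = 0 ↔ B i j = 0) ∧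
        ∀ i, ∑ j, B i j = r i := by
  constructor
  · rintro ⟨d, hd, hr⟩
    obtain ⟨hnn, hsym, hp⟩ := symmetric_pattern_of_scaling hA hAs hd
    exact ⟨of fun i j ↦ d i * A i j * d j, fun i j ↦ hnn i j, fun i j ↦ hsym i j, fun i j ↦ hp i j, hr⟩
  · rintro ⟨B, hB, hBs, hpat, hBr⟩
    exact exists_symmetric_scaling_of_pattern hA hAs hB hBs hpat hBr

/-- **The symmetric scaled matrix `DAD` is unique** (given the row sums): two positive `d, d'` with
`(d_i a_ij d_j)`, `(d'_i a_ij d'_j)` both of row sums `r` give the same matrix (uniqueness of the scaled matrix for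
the margins `(r, r)`, ✔ `MatrixScalingPattern.scaledMatrix_unique`). [cite: Idel2016, §5 Theorem 5.4 («Furthermore,
the scaling is unique»), p0016] -/
theorem symmetric_scaledMatrix_unique (hA : ∀ i j, 0 ≤ A i j) (hAs : ∀ i j, A i j = A j i) {d d' : n → ℝ}
    (hd : ∀ i, 0 < d i) (hd' : ∀ i, 0 < d' i) (hr : ∀ i, ∑ j, d i * A i j * d j = r i)
    (hr' : ∀ i, ∑ j, d' i * A i j * d' j = r i) (i j : n) : d' i * A i j * d' j = d i * A i j * d j := by
  have hc : ∀ j, ∑ i, d i * A i j * d j = r j := fun j ↦ by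
    rw [← hr j]; exact sum_congr rfl fun i _ ↦ by rw [hAs i j]; ring
  have hc' : ∀ j, ∑ i, d' i * A i j * d' j = r j := fun j ↦ by
    rw [← hr' j]; exact sum_congr rfl fun i _ ↦ by rw [hAs i j]; ring
  exact MatrixScalingPattern.scaledMatrix_unique hA hd hd' hd hd' (fun i ↦ by rw [hr' i, hr i])
    (fun j ↦ by rw [hc' j, hc j]) i j

/-- … and `D` itself is unique when the diagonal of `A` is positive (`d'_i² a_ii = d_i² a_ii`). In general `D` is
NOT unique: see `symmetric_scaling_not_unique`. [cite: Idel2016, §5 Theorem 5.4 («the scaling is unique»), p0016] -/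
theorem symmetric_scaling_unique_of_pos_diag (hA : ∀ i j, 0 ≤ A i j) (hAs : ∀ i j, A i j = A j i)
    (hdiag : ∀ i, 0 < A i i) {d d' : n → ℝ} (hd : ∀ i, 0 < d i) (hd' : ∀ i, 0 < d' i)
    (hr : ∀ i, ∑ j, d i * A i j * d j = r i) (hr' : ∀ i, ∑ j, d' i * A i j * d' j = r i) : d' = d := by
  funext i
  have h := symmetric_scaledMatrix_unique hA hAs hd hd' hr hr' i i
  have h2 : d' i * d' i = d i * d i := by
    have : d' i * d' i * A i i = d i * d i * A i i := by linarith [h]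
    exact mul_right_cancel₀ (hdiag i).ne' this
  nlinarith [hd i, hd' i, h2, sq_nonneg (d' i - d i), sq_nonneg (d' i + d i)]

omit [Fintype n] in
/-- Without a positive diagonal the matrix `D` need not be unique: for `A = (0 1; 1 0)` both `D = I` and
`D = diag(2, 1/2)` give `DAD = A` (row sums `(1, 1)`). [cite: Idel2016, §5 Theorem 5.4 (scope of «the scaling is
unique»: the scaled matrix, not `D`), p0016] -/
theorem symmetric_scaling_not_unique :
    (∀ i, ∑ j, (![1, 1] : Fin 2 → ℝ) i * (!![0, 1; 1, 0] : Matrix (Fin 2) (Fin 2) ℝ) i j * (![1, 1] : Fin 2 → ℝ) j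
        = 1) ∧
    (∀ i, ∑ j, (![2, 1/2] : Fin 2 → ℝ) i * (!![0, 1; 1, 0] : Matrix (Fin 2) (Fin 2) ℝ) i j *
        (![2, 1/2] : Fin 2 → ℝ) j = 1) ∧
    (![1, 1] : Fin 2 → ℝ) ≠ ![2, 1/2] := by
  refine ⟨fun i ↦ ?_, fun i ↦ ?_, fun h ↦ ?_⟩
  · fin_cases i <;> norm_num [Fin.sum_univ_two]
  · fin_cases i <;> norm_num [Fin.sum_univ_two]
  · have := congr_fun h 0
    norm_num at this

/-! ### §2 Doubly stochastic symmetric scaling (Csima–Datta, as quoted by Idel) -/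

/-- Entries of `D(d) A D(d)`. [folklore] -/
private theorem diag_mul_diag_apply [DecidableEq n] (y : n → ℝ) (A : Matrix n n ℝ) (x : n → ℝ) (i j : n) :
    (diagonal y * A * diagonal x) i j = y i * A i j * x j := by
  simp [mul_diagonal, diagonal_mul]

/-- **Symmetric doubly stochastic scaling** («[csi72] shows that a doubly stochastic scaling exists if and only if
there exists a symmetric doubly stochastic matrix with the same zero pattern»): for symmetric `A ≥ 0`,
`DAD` is doubly stochastic for some positive diagonal `D` iff some symmetric doubly stochastic matrix has the
pattern of `A` — Theorem 5.4 with `r = e`. [cite: Idel2016, §5 (before Theorem 5.4, [csi72]) with Theorem 5.4,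
p0015–p0016] -/
theorem exists_symmetric_doublyStochastic_scaling_iff [DecidableEq n] (hA : ∀ i j, 0 ≤ A i j)
    (hAs : ∀ i j, A i j = A j i) :
    (∃ d : n → ℝ, (∀ i, 0 < d i) ∧ diagonal d * A * diagonal d ∈ doublyStochastic ℝ n) ↔
      ∃ B ∈ doublyStochastic ℝ n, (∀ i j, B i j = B j i) ∧ ∀ i j, A i j = 0 ↔ B i j = 0 := by
  rw [show (∃ d : n → ℝ, (∀ i, 0 < d i) ∧ diagonal d * A * diagonal d ∈ doublyStochastic ℝ n) ↔
      ∃ d : n → ℝ, (∀ i, 0 < d i) ∧ ∀ i, ∑ j, d i * A i j * d j = (fun _ ↦ (1:ℝ)) i from ?_]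
  · rw [Idel2016_thm_5_4 hA hAs]
    constructor
    · rintro ⟨B, hB, hBs, hpat, hBr⟩
      refine ⟨B, mem_doublyStochastic_iff_sum.2 ⟨hB, hBr, fun j ↦ ?_⟩, hBs, hpat⟩
      rw [← hBr j]; exact sum_congr rfl fun i _ ↦ hBs i j
    · rintro ⟨B, hB, hBs, hpat⟩
      obtain ⟨hB0, hBr, -⟩ := mem_doublyStochastic_iff_sum.1 hB
      exact ⟨B, hB0, hBs, hpat, hBr⟩
  · refine exists_congr fun d ↦ and_congr_right fun hd ↦ ?_
    rw [mem_doublyStochastic_iff_sum]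
    simp only [diag_mul_diag_apply]
    constructor
    · rintro ⟨-, hr, -⟩; exact hr
    · intro hr
      refine ⟨fun i j ↦ mul_nonneg (mul_nonneg (hd i).le (hA i j)) (hd j).le, hr, fun j ↦ ?_⟩
      rw [← hr j]; exact sum_congr rfl fun i _ ↦ by rw [hAs i j]; ring

/-! ### §3 The bipartite double: equivalence scaling of `A` = symmetric scaling of `(0 A; Aᵀ 0)` (Observation 5.5) -/

/-- **Idel Observation 5.5.** «Let `A ∈ ℝ^{m×n}` be a matrix and `r ∈ ℝ^m_+`, `c ∈ ℝ^n_+` be two prescribed vectors.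
Then `A` has an equivalence scaling if and only if the following symmetric matrix `A' = (0 A; Aᵀ 0)` has a
row-sum symmetric scaling to `(r')ᵀ = (rᵀ, cᵀ)`.» (`D' = diag(D₁, D₂)`.) [cite: Idel2016, §5 Observation 5.5 with
its proof, p0016] -/
theorem Idel2016_obs_5_5 (A : Matrix m n ℝ) (r : m → ℝ) (c : n → ℝ) :
    (∃ x : n → ℝ, ∃ y : m → ℝ, (∀ j, 0 < x j) ∧ (∀ i, 0 < y i) ∧
        (∀ i, ∑ j, y i * A i j * x j = r i) ∧ (∀ j, ∑ i, y i * A i j * x j = c j)) ↔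
      ∃ d : m ⊕ n → ℝ, (∀ k, 0 < d k) ∧
        ∀ k, ∑ l, d k * (fromBlocks 0 A Aᵀ 0) k l * d l = Sum.elim r c k := by
  constructor
  · rintro ⟨x, y, hx, hy, hrow, hcol⟩
    refine ⟨Sum.elim y x, fun k ↦ by cases k <;> simp [hx, hy], fun k ↦ ?_⟩
    cases k with
    | inl i =>
      simp only [Fintype.sum_sum_type, Sum.elim_inl, Sum.elim_inr, fromBlocks_apply₁₁, fromBlocks_apply₁₂,
        Matrix.zero_apply, mul_zero, zero_mul, sum_const_zero, zero_add]
      exact hrow i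
    | inr j =>
      simp only [Fintype.sum_sum_type, Sum.elim_inl, Sum.elim_inr, fromBlocks_apply₂₁, fromBlocks_apply₂₂,
        Matrix.zero_apply, transpose_apply, mul_zero, zero_mul, sum_const_zero, add_zero]
      rw [← hcol j]
      exact sum_congr rfl fun i _ ↦ by ring
  · rintro ⟨d, hd, hsum⟩
    refine ⟨fun j ↦ d (Sum.inr j), fun i ↦ d (Sum.inl i), fun j ↦ hd _, fun i ↦ hd _, fun i ↦ ?_, fun j ↦ ?_⟩
    · have h := hsum (Sum.inl i)
      simp only [Fintype.sum_sum_type, Sum.elim_inl, fromBlocks_apply₁₁, fromBlocks_apply₁₂,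
        Matrix.zero_apply, mul_zero, zero_mul, sum_const_zero, zero_add] at h
      exact h
    · have h := hsum (Sum.inr j)
      simp only [Fintype.sum_sum_type, Sum.elim_inr, fromBlocks_apply₂₁, fromBlocks_apply₂₂,
        Matrix.zero_apply, transpose_apply, mul_zero, zero_mul, sum_const_zero, add_zero] at h
      rw [← h]
      exact sum_congr rfl fun i _ ↦ by ring

end Literature.LinearAlgebra.Matrix.SymmetricMatrixScaling
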